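import Literature.MathematicalPhysics.KineticTheory.IllnerPulvirentiCollisionDispersive
import Literature.MathematicalPhysics.KineticTheory.IllnerPulvirentiChainEstimate
import HarnessLib

/-!
# Global bounds for the Duhamel series of the Boltzmann hierarchy on `ℝ^d` (CIP 1994 Thm 4.5.1, Step 3)

Topic: MathematicalPhysics / KineticTheory. A brick of the convergence half of the named fact
`Literature.MathematicalPhysics.KineticTheory.illner_pulvirenti` (global validity of the
Boltzmann equation for a rare gas cloud in all space; Cercignani–Illner–Pulvirenti 1994
Thm 4.5.1; Illner–Pulvirenti 1986/1989).

**Theorem** (`abs_boltzmannDuhamelTerm_le_global`). Let `d ≥ 2`, `β₀, λ > 0`, and let the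
initial family satisfy the rare-cloud bound
`|F₀^{(s+n)}(Z)| ≤ K e^{-β₀ ∑ |x_j|²} e^{-λ H(Z)}` (`H = ½ ∑ |v_j|²`; for tensorised data
`f₀^{⊗(s+n)}` with `0 ≤ f₀ ≤ c e^{-β₀|x|² - (λ/2)|v|²}` take `K = c^{s+n}`). Then for ALL `t ≥ 0`
and all `Z_s`, `n ≥ 1`,

  `|Q⁰_{s,s+n}(t) F₀ (Z_s)| ≤ e^{s-1} (C_{d,β₀,λ} / λ^{(d+1)/2})ⁿ K e^{-β₀ I_t(Z_s)} e^{-(λ/2) H(Z_s)}`,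

`I_t(Z_s) = ∑ |x_j - t v_j|²`, with a constant `C_{d,β₀,λ}` NOT depending on `t`
(explicitly `e² 2^{(d+3)/2} |S^{d-1}| 2^d (2^d G₁ + λ^{d/2} G_{β₀})`, `G_c = ∫ e^{-c|u|²} du`).
This is the bound "for the series solution of the Boltzmann hierarchy" of the last paragraph of
the proof of CIP 1994 Thm 4.5.1 (p. 90), i.e. (5.9) at `ε = 0`: geometric in `n` uniformly in
time, hence a convergent majorant for `K = c^{s+n}` with `c` small ("if `b·α` is sufficiently
small").

Proof: the abstract global chain estimate `abs_duhamelTerm_le_dispersive_of_le` with the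
dispersive factor `Dsp_τ = e^{-β₀ I_τ}`, carried exactly by free transport
(`abs_freeTransport_le_dispersive`), the dispersive single-step estimate
`abs_boltzmannHOp_le_dispersive` with cost `A(τ) = |S| 2^d (2^d G₁ + λ^{d/2} G_{β₀}) (1 + |τ|)^{-d}`,
the BGSR weight bookkeeping (`λ_m = λ₀ = λ/2`, `δ = λ/2n`, `k_max = s + n - 1`, ceiling `λ`;
`chainConst_le`, `pow_chainConst_mul_le`), and the time integral
`∫₀ᵗ (1 + σ)^{-d} dσ ≤ ∫₀ᵗ (1 + σ)^{-2} dσ ≤ 1` for `d ≥ 2`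
(`intervalIntegral_inv_one_add_pow_le_one`) — the only place where the dimension enters.

## References

* C. Cercignani, R. Illner, M. Pulvirenti, *The Mathematical Theory of Dilute Gases*, Applied
  Mathematical Sciences 106, Springer (1994), §4.5, proof of Thm 4.5.1, Step 3, (5.1)–(5.9),
  pp. 88–90.
* R. Illner, M. Pulvirenti, Comm. Math. Phys. 105 (1986) 189–203; 121 (1989) 143–146.
-/

open MeasureTheory Metric Real Set Filter Topology
open scoped InnerProductSpace ENNReal Nat
open Literature.Analysis.FluidPDE

namespace Literature.MathematicalPhysics.KineticTheory

noncomputable section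

variable {d : Type*} [Fintype d]

/-! ## The time integral of the dispersion decay -/

/-- `∫₀ᵗ (1 + σ)^{-2} dσ = 1 - (1 + t)^{-1} ≤ 1` for `t ≥ 0` (fundamental theorem of calculus).
[folklore] -/
theorem intervalIntegral_inv_one_add_sq_le_one {t : ℝ} (ht : 0 ≤ t) :
    ∫ σ in (0 : ℝ)..t, ((1 + σ) ^ 2)⁻¹ ≤ 1 := by
  have hderiv : ∀ x ∈ uIcc 0 t, HasDerivAt (fun σ : ℝ => -(1 + σ)⁻¹) (((1 + x) ^ 2)⁻¹) x := by
    intro x hx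
    rw [uIcc_of_le ht] at hx
    have hx1 : (1 + x) ≠ 0 := by linarith [hx.1]
    have h1 : HasDerivAt (fun σ : ℝ => 1 + σ) 1 x := by
      simpa using (hasDerivAt_id x).const_add 1
    have h2 := (h1.inv hx1).neg
    refine h2.congr_deriv ?_
    rw [neg_div, neg_neg, one_div]
  have hcont : ContinuousOn (fun σ : ℝ => ((1 + σ) ^ 2)⁻¹) (uIcc 0 t) := by
    refine ContinuousOn.inv₀ (by fun_prop) fun x hx => ?_
    rw [uIcc_of_le ht] at hx
    have : 0 < 1 + x := by linarith [hx.1]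
    positivity
  rw [intervalIntegral.integral_eq_sub_of_hasDerivAt hderiv (hcont.intervalIntegrable)]
  have : 0 < 1 + t := by linarith
  have hinv : 0 ≤ (1 + t)⁻¹ := by positivity
  simp only [add_zero, inv_one]
  linarith

/-- For `D ≥ 2` and `t ≥ 0`, `∫₀ᵗ (1 + |σ|)^{-D} dσ ≤ 1`. [folklore] -/
theorem intervalIntegral_inv_one_add_abs_pow_le_one {D : ℕ} (hD : 2 ≤ D) {t : ℝ} (ht : 0 ≤ t) :
    ∫ σ in (0 : ℝ)..t, ((1 + |σ|) ^ D)⁻¹ ≤ 1 := by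
  refine (intervalIntegral.integral_mono_on ht ?_ ?_ fun σ hσ => ?_).trans
    (intervalIntegral_inv_one_add_sq_le_one ht)
  · exact (Continuous.inv₀ (by fun_prop) fun σ => by positivity).intervalIntegrable _ _
  · refine (ContinuousOn.inv₀ (by fun_prop) fun x hx => ?_).intervalIntegrable
    rw [uIcc_of_le ht] at hx
    have : 0 < 1 + x := by linarith [hx.1]
    positivity
  · rw [abs_of_nonneg hσ.1]
    have h1 : (1 : ℝ) ≤ 1 + σ := by linarith [hσ.1]
    have h0 : 0 < (1 + σ) ^ 2 := by positivity
    exact inv_anti₀ h0 (pow_le_pow_right₀ h1 hD)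

/-! ## The global bound on Duhamel chains of the Boltzmann hierarchy -/

/-- **Global-in-time bound on the Duhamel chains of the Boltzmann hierarchy on `ℝ^d`**
(CIP 1994 Thm 4.5.1, Step 3, (5.7)–(5.9) at `ε = 0`; Illner–Pulvirenti 1986/1989), for ANY
family `R n s t` obeying the Duhamel recursion of the Boltzmann hierarchy
`R (n+1) s t = ∫₀ᵗ S_s(t-τ) C⁰_{s,s+1} (R n (s+1) τ) dτ` — both the Duhamel terms
`Q⁰_{s,s+n}(t) F₀` (innermost slot `S(τ) F₀^{(s+n)}`) and the remainders of the finitely iterated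
Duhamel formula of a mild solution (innermost slot `F^{(s+n)}(τ)`) are covered. Let `d ≥ 2`,
`β₀, λ > 0`, `n ≥ 1`, `K ≥ 0`, and let the innermost slot satisfy the rare-cloud bound
`|R 0 (s+n) τ (Z)| ≤ K e^{-β₀ ∑_j |x_j - τ v_j|²} e^{-λ H(Z)}` for `τ ∈ [0, T]`. Then for
`t ∈ [0, T]` and every `Z_s`,
`|R n s t (Z_s)| ≤ e^{s-1} (e² 2^{(d+3)/2} C∞ / λ^{(d+1)/2})ⁿ K e^{-β₀ ∑_j |x_j - t v_j|²} e^{-(λ/2) H(Z_s)}`,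
`C∞ = |S^{d-1}| 2^d (2^d ∫ e^{-|u|²} + λ^{d/2} ∫ e^{-β₀|u|²})` — a constant NOT depending on `t`
or `T`. [cite: CIP1994, §4.5 (5.7)–(5.9)] -/
theorem abs_boltzmannChain_le_global (hd : 2 ≤ Fintype.card d) {β₀ lam K : ℝ}
    (hβ₀ : 0 < β₀) (hlam : 0 < lam) (hK : 0 ≤ K)
    (R : ℕ → (s : ℕ) → ℝ → Config s d (EuclideanSpace ℝ d) → ℝ)
    (hR : ∀ (n s : ℕ) (t : ℝ) (Z : Config s d (EuclideanSpace ℝ d)),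
      R (n + 1) s t Z = ∫ τ in (0 : ℝ)..t,
        freeTransport (Euclidean.geometry d) s (t - τ)
          (boltzmannHOp (Euclidean.geometry d) s (R n (s + 1) τ)) Z)
    {T : ℝ} (hT : 0 ≤ T) (s n : ℕ) (hn : 1 ≤ n)
    (h0 : ∀ τ ∈ Icc 0 T, ∀ Z : Config (s + n) d (EuclideanSpace ℝ d), |R 0 (s + n) τ Z| ≤
      K * (exp (-β₀ * ∑ j, ‖(Z j).1 - τ • (Z j).2‖ ^ 2) * exp (-lam * configEnergy Z)))
    {t : ℝ} (ht : t ∈ Icc 0 T) (Z : Config s d (EuclideanSpace ℝ d)) :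
    |R n s t Z| ≤
      exp (s - 1) *
        (exp 2 * (sqrt 2 ^ (Fintype.card d + 3) / sqrt lam ^ (Fintype.card d + 1)) *
          ((KineticTheory.sphereMeasure : Measure (sphere (0 : EuclideanSpace ℝ d) 1)).real univ *
            (2 ^ Fintype.card d *
              (2 ^ Fintype.card d * (∫ w : EuclideanSpace ℝ d, exp (-‖w‖ ^ 2)) +
                sqrt lam ^ Fintype.card d * ∫ w : EuclideanSpace ℝ d, exp (-β₀ * ‖w‖ ^ 2))))) ^ n *
        K * (exp (-β₀ * ∑ j, ‖(Z j).1 - t • (Z j).2‖ ^ 2) * exp (-(lam / 2) * configEnergy Z)) := by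
  set D : ℕ := Fintype.card d with hD
  set S : ℝ := (KineticTheory.sphereMeasure : Measure (sphere (0 : EuclideanSpace ℝ d) 1)).real univ
    with hS
  set Cβ : ℝ := 2 ^ D * (2 ^ D * (∫ w : EuclideanSpace ℝ d, exp (-‖w‖ ^ 2)) +
      sqrt lam ^ D * ∫ w : EuclideanSpace ℝ d, exp (-β₀ * ‖w‖ ^ 2)) with hCβ
  have hS0 : 0 ≤ S := measureReal_nonneg
  have hCβ0 : 0 ≤ Cβ := by
    have h1 : 0 ≤ ∫ w : EuclideanSpace ℝ d, exp (-‖w‖ ^ 2) := integral_nonneg fun w => (exp_pos _).le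
    have h2 : 0 ≤ ∫ w : EuclideanSpace ℝ d, exp (-β₀ * ‖w‖ ^ 2) :=
      integral_nonneg fun w => (exp_pos _).le
    positivity
  -- the dispersive factor, the cost and the weights
  set Dsp : ℝ → (m : ℕ) → Config m d (EuclideanSpace ℝ d) → ℝ := fun τ m Z' =>
    exp (-β₀ * ∑ j, ‖(Z' j).1 - τ • (Z' j).2‖ ^ 2) with hDsp_def
  have hDsp : ∀ τ m Z', 0 ≤ Dsp τ m Z' := fun τ m Z' => (exp_pos _).le
  set A : ℝ → ℝ := fun τ => S * Cβ * ((1 + |τ|) ^ D)⁻¹ with hA_def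
  have hApos : ∀ τ : ℝ, 0 < (1 + |τ|) ^ D := fun τ => by positivity
  have hAc : Continuous A := by
    simp only [hA_def]
    exact continuous_const.mul (Continuous.inv₀ (by fun_prop) fun τ => (hApos τ).ne')
  have hA0 : ∀ τ, 0 ≤ A τ := fun τ => by
    simp only [hA_def]
    exact mul_nonneg (mul_nonneg hS0 hCβ0) (inv_nonneg.2 (hApos τ).le)
  -- the parameters of the chain
  have hbm : 0 < lam / 2 := half_pos hlam
  have hn0 : (0 : ℝ) < n := by exact_mod_cast hn
  have hδ : 0 < lam / (2 * n) := by positivity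
  have hkmax : s + n ≤ (s + n - 1) + 1 := by omega
  have hsum : lam / 2 + n * (lam / (2 * n)) = lam := by field_simp; ring
  have hbmax : lam / 2 + n * (lam / (2 * n)) ≤ lam := hsum.le
  -- the hypotheses of the abstract chain estimate
  have htr : ∀ (m : ℕ) (b τ t' : ℝ), 0 ≤ τ → τ ≤ t' →
      ∀ (g : Config m d (EuclideanSpace ℝ d) → ℝ) (K' : ℝ), 0 ≤ K' →
      (∀ Z', |g Z'| ≤ K' * (Dsp τ m Z' * exp (-b * configEnergy Z'))) →
      ∀ Z', |freeTransport (Euclidean.geometry d) m (t' - τ) g Z'| ≤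
        K' * (Dsp t' m Z' * exp (-b * configEnergy Z')) :=
    fun m b τ t' _ _ g K' _ hg Z' => abs_freeTransport_le_dispersive m b β₀ τ t' g K' hg Z'
  have hop : ∀ (k : ℕ) (g : Config (k + 1) d (EuclideanSpace ℝ d) → ℝ) (K' b τ : ℝ),
      0 < b → b ≤ lam → 0 ≤ K' → 0 ≤ τ →
      (∀ Z', |g Z'| ≤ K' * (Dsp τ (k + 1) Z' * exp (-b * configEnergy Z'))) →
      ∀ Z' : Config k d (EuclideanSpace ℝ d), |boltzmannHOp (Euclidean.geometry d) k g Z'| ≤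
        A τ * (sqrt b ^ Fintype.card d)⁻¹ * (k * (sqrt b)⁻¹ + ∑ i, ‖(Z' i).2‖) *
          (K' * (Dsp τ k Z' * exp (-b * configEnergy Z'))) := by
    intro k g K' b τ hb hble hK' hτ hg Z'
    have h := abs_boltzmannHOp_le_dispersive k hb hble hβ₀ hτ hK' hg Z'
    have hAτ : A τ = S * (Cβ / (1 + τ) ^ D) := by
      simp only [hA_def, abs_of_nonneg hτ]
      ring
    rw [hAτ]
    simpa only [hS, hCβ, hD, mul_assoc] using h
  -- the innermost slot
  have h0' : ∀ τ ∈ Icc 0 T, ∀ Z' : Config (s + n) d (EuclideanSpace ℝ d), |R 0 (s + n) τ Z'| ≤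
      K * (Dsp τ (s + n) Z' * exp (-(lam / 2 + n * (lam / (2 * n))) * configEnergy Z')) := by
    intro τ hτ Z'
    rw [hsum]
    exact h0 τ hτ Z'
  -- the abstract chain estimate
  have hchain := abs_duhamelChain_le_dispersive_of_le (X := EuclideanSpace ℝ d)
    (transport := freeTransport (Euclidean.geometry d)) (op := boltzmannHOp (Euclidean.geometry d))
    hDsp htr hAc hA0 hop R hR hT hbm hδ (s + n - 1) n s (s + n) rfl hkmax le_rfl hbmax hK h0' t ht Z
  refine hchain.trans ?_
  -- the time integral of the cost is at most `S Cβ`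
  have hM : ∫ σ in (0 : ℝ)..t, A σ ≤ S * Cβ := by
    simp only [hA_def]
    rw [intervalIntegral.integral_const_mul]
    calc S * Cβ * ∫ σ in (0 : ℝ)..t, ((1 + |σ|) ^ D)⁻¹ ≤ S * Cβ * 1 :=
          mul_le_mul_of_nonneg_left (intervalIntegral_inv_one_add_abs_pow_le_one hd ht.1)
            (mul_nonneg hS0 hCβ0)
      _ = S * Cβ := mul_one _
  have hM0 : 0 ≤ ∫ σ in (0 : ℝ)..t, A σ := intervalIntegral.integral_nonneg ht.1 fun σ _ => hA0 σ
  -- the BGSR constants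
  have hΛ := chainConst_le (A := 1) zero_le_one hlam s n D
  rw [one_mul, one_mul] at hΛ
  set Λ : ℝ := (sqrt (lam / 2) ^ D)⁻¹ *
    ((s + n - 1 : ℕ) * (sqrt (lam / 2))⁻¹ + sqrt ((s + n - 1 : ℕ) / (lam / (2 * n)))) with hΛdef
  set Λ' : ℝ := sqrt 2 ^ (D + 3) / sqrt lam ^ (D + 1) with hΛ'
  have hΛ0 : 0 ≤ Λ := by positivity
  have hΛ'0 : 0 ≤ Λ' := by positivity
  have hW0 : 0 ≤ Dsp t s Z * exp (-(lam / 2) * configEnergy Z) := by positivity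
  -- `Λⁿ Mⁿ / n! ≤ (Λ' (s+n))ⁿ (S Cβ)ⁿ / n! ≤ e^{s-1} (e² Λ' S Cβ)ⁿ`
  have hstep1 : Λ ^ n * (∫ σ in (0 : ℝ)..t, A σ) ^ n / n ! ≤
      (Λ' * (s + n : ℕ)) ^ n * (S * Cβ) ^ n / n ! := by
    have h1 : Λ ^ n ≤ (Λ' * (s + n : ℕ)) ^ n := pow_le_pow_left₀ hΛ0 hΛ n
    have h2 : (∫ σ in (0 : ℝ)..t, A σ) ^ n ≤ (S * Cβ) ^ n := pow_le_pow_left₀ hM0 hM n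
    have h3 : 0 ≤ (Λ' * (s + n : ℕ)) ^ n := by positivity
    rw [div_le_div_iff_of_pos_right (by positivity : (0 : ℝ) < n !)]
    exact mul_le_mul h1 h2 (by positivity) h3
  have hstep2 := pow_chainConst_mul_le hΛ'0 (mul_nonneg hS0 hCβ0) s n hn
  calc K * Λ ^ n * (∫ σ in (0 : ℝ)..t, A σ) ^ n / n ! *
        (Dsp t s Z * exp (-(lam / 2) * configEnergy Z))
      = (Λ ^ n * (∫ σ in (0 : ℝ)..t, A σ) ^ n / n !) *
          (K * (Dsp t s Z * exp (-(lam / 2) * configEnergy Z))) := by ring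
    _ ≤ ((Λ' * (s + n : ℕ)) ^ n * (S * Cβ) ^ n / n !) *
          (K * (Dsp t s Z * exp (-(lam / 2) * configEnergy Z))) :=
        mul_le_mul_of_nonneg_right hstep1 (mul_nonneg hK hW0)
    _ ≤ (exp (s - 1) * (exp 2 * Λ' * (S * Cβ)) ^ n) *
          (K * (Dsp t s Z * exp (-(lam / 2) * configEnergy Z))) :=
        mul_le_mul_of_nonneg_right hstep2 (mul_nonneg hK hW0)
    _ = _ := by
        simp only [hΛ', hDsp_def]
        ring

/-- **Global-in-time bounds for the Duhamel series of the Boltzmann hierarchy on `ℝ^d`**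
(CIP 1994 Thm 4.5.1, Step 3, (5.9) at `ε = 0`, and the last paragraph of its proof, p. 90;
Illner–Pulvirenti 1986/1989). Let `d ≥ 2`, `β₀ > 0`, `λ > 0`, `n ≥ 1`, and let the initial
family satisfy `|F₀^{(s+n)}(Z)| ≤ K e^{-β₀ ∑_j |x_j|²} e^{-λ H(Z)}`, `K ≥ 0`. Then for every `t ≥ 0`
and `Z_s`,
`|Q⁰_{s,s+n}(t) F₀ (Z_s)| ≤ e^{s-1} (e² 2^{(d+3)/2} C∞ / λ^{(d+1)/2})ⁿ K e^{-β₀ ∑_j |x_j - t v_j|²} e^{-(λ/2) H(Z_s)}`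
with the time-independent constant `C∞ = |S^{d-1}| 2^d (2^d ∫ e^{-|u|²} + λ^{d/2} ∫ e^{-β₀|u|²})`.
[cite: CIP1994, §4.5 (5.9)] -/
theorem abs_boltzmannDuhamelTerm_le_global (hd : 2 ≤ Fintype.card d) {β₀ lam K : ℝ}
    (hβ₀ : 0 < β₀) (hlam : 0 < lam) (hK : 0 ≤ K)
    (F₀ : GCState d (EuclideanSpace ℝ d)) (s n : ℕ) (hn : 1 ≤ n)
    (hF : ∀ Z : Config (s + n) d (EuclideanSpace ℝ d), |F₀ (s + n) Z| ≤
      K * (exp (-β₀ * ∑ j, ‖(Z j).1‖ ^ 2) * exp (-lam * configEnergy Z)))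
    {t : ℝ} (ht : 0 ≤ t) (Z : Config s d (EuclideanSpace ℝ d)) :
    |boltzmannDuhamelTerm (Euclidean.geometry d) n s t F₀ Z| ≤
      exp (s - 1) *
        (exp 2 * (sqrt 2 ^ (Fintype.card d + 3) / sqrt lam ^ (Fintype.card d + 1)) *
          ((KineticTheory.sphereMeasure : Measure (sphere (0 : EuclideanSpace ℝ d) 1)).real univ *
            (2 ^ Fintype.card d *
              (2 ^ Fintype.card d * (∫ w : EuclideanSpace ℝ d, exp (-‖w‖ ^ 2)) +
                sqrt lam ^ Fintype.card d * ∫ w : EuclideanSpace ℝ d, exp (-β₀ * ‖w‖ ^ 2))))) ^ n *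
        K * (exp (-β₀ * ∑ j, ‖(Z j).1 - t • (Z j).2‖ ^ 2) * exp (-(lam / 2) * configEnergy Z)) := by
  refine abs_boltzmannChain_le_global hd hβ₀ hlam hK
    (fun n s t => boltzmannDuhamelTerm (Euclidean.geometry d) n s t F₀)
    (fun n s t Z => duhamelTerm_succ _ _ n s t F₀ Z) ht s n hn (fun τ hτ Z' => ?_) ⟨ht, le_rfl⟩ Z
  -- the innermost slot `S(τ) F₀^{(s+n)}` at time `τ`
  rw [boltzmannDuhamelTerm, duhamelTerm_zero]
  have hF' : ∀ Z'' : Config (s + n) d (EuclideanSpace ℝ d), |F₀ (s + n) Z''| ≤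
      K * (exp (-β₀ * ∑ j, ‖(Z'' j).1 - (0 : ℝ) • (Z'' j).2‖ ^ 2) *
        exp (-lam * configEnergy Z'')) := fun Z'' => by
    simpa only [zero_smul, sub_zero] using hF Z''
  have h := abs_freeTransport_le_dispersive (s + n) lam β₀ 0 τ (F₀ (s + n)) K hF' Z'
  rwa [sub_zero] at h

end

end Literature.MathematicalPhysics.KineticTheory
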